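import Mathlib
import HarnessLib

/-!
# A real operator has complex-conjugate determinants on conjugate eigenspaces

Layer `Literature/AlgebraicGeometry/HodgeTheory`, pure linear algebra. Let `V` be a finite-dimensional
complex vector space with a basis `b`, and let `J, M ∈ End V` have REAL matrices in `b` (e.g. `V = Λ ⊗ ℂ`
for a lattice `Λ` with integral basis `b`, `J` a complex-multiplication operator and `M` a monodromy
operator preserving `Λ`). Coordinatewise complex conjugation `κ` in `b` is a conjugate-linear involution of
`V` commuting with `J` and `M` (`apply_coordConj_of_toMatrix_im_eq_zero`), so it maps the eigenspace
`V_μ(J)` onto `V_{μ̄}(J)` and intertwines the restrictions of `M`; hence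
`det (M | V_{μ̄}(J)) = conj (det (M | V_μ(J)))` (`det_restrict_eigenspace_conj`). The abstract step — an
endomorphism intertwined with another through a CONJUGATE-linear equivalence has the conjugate
determinant (its matrix in the transported basis is the entrywise conjugate) — is
`det_eq_conj_det_of_semilinearEquiv`.

This is the tool behind "a level-`n` structure forces special unitary monodromy on the Weil lines": for
an abelian variety of Weil type with `K = ℚ(√-d)` acting through `J` (`J² = -d`), the monodromy `γ` of a
family with level structure is integral, commutes with `J`, and `det (γ | V_{i√d}) · det (γ | V_{-i√d})`,
`det (γ | V_{-i√d}) = conj det (γ | V_{i√d})` reduce `det_K γ = 1` to a statement about one eigenspace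
(B. van Geemen, LNM 1594, 5.8–5.11). Everything here is proved; no definition and no named fact is
introduced.

## References

* [vanGeemen1994HodgeAV] B. van Geemen, An introduction to the Hodge conjecture for abelian varieties,
  LNM 1594 (1994), 5.8–5.11.
-/

namespace Literature.AlgebraicGeometry.HodgeTheory

/-- **Intertwining by a conjugate-linear equivalence conjugates the determinant.** If
`φ : E₁ ≃ E₂` is conjugate-linear (`φ (c • x) = c̄ • φ x`) and `g ∘ φ = φ ∘ f` for endomorphisms `f` of
`E₁` and `g` of `E₂` (`E₁` finite-dimensional over `ℂ`), then `det g = conj (det f)`: in the basis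
`φ (e j)` of `E₂` transported from a basis `e` of `E₁` the matrix of `g` is the entrywise conjugate of the
matrix of `f` in `e`, and `det` commutes with ring homomorphisms applied entrywise. [folklore] -/
theorem det_eq_conj_det_of_semilinearEquiv {E₁ E₂ : Type*} [AddCommGroup E₁] [Module ℂ E₁]
    [FiniteDimensional ℂ E₁] [AddCommGroup E₂] [Module ℂ E₂] (φ : E₁ ≃ₛₗ[starRingEnd ℂ] E₂)
    (f : Module.End ℂ E₁) (g : Module.End ℂ E₂) (h : ∀ x, g (φ x) = φ (f x)) :
    LinearMap.det g = (starRingEnd ℂ) (LinearMap.det f) := by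
  classical
  let e := Module.finBasis ℂ E₁
  let L : E₂ ≃ₗ[ℂ] (Fin (Module.finrank ℂ E₁) → ℂ) :=
    (φ.symm.trans e.equivFun).trans (starLinearEquiv ℂ)
  let e' : Module.Basis (Fin (Module.finrank ℂ E₁)) ℂ E₂ := Module.Basis.ofEquivFun L
  have hr : ∀ (y : E₂) (k : Fin (Module.finrank ℂ E₁)), e'.repr y k = star (e.repr (φ.symm y) k) :=
    fun y k => rfl
  have hsymm : ∀ y, φ.symm (g y) = f (φ.symm y) := fun y =>
    φ.injective (by rw [LinearEquiv.apply_symm_apply, ← h, LinearEquiv.apply_symm_apply])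
  have hφe' : ∀ j, φ.symm (e' j) = e j := fun j => e.ext_elem fun k => by
    rw [← star_star ((e.repr (φ.symm (e' j))) k), ← hr, e'.repr_self, e.repr_self,
      Finsupp.single_apply]
    split_ifs <;> simp
  have hmat : LinearMap.toMatrix e' e' g = (LinearMap.toMatrix e e f).map (starRingEnd ℂ) := by
    ext i j
    rw [Matrix.map_apply, LinearMap.toMatrix_apply, LinearMap.toMatrix_apply, hr, hsymm, hφe']
    rfl
  rw [← LinearMap.det_toMatrix e', hmat, ← RingHom.mapMatrix_apply, ← RingHom.map_det,
    LinearMap.det_toMatrix]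

section

variable {V : Type*} [AddCommGroup V] [Module ℂ V] [FiniteDimensional ℂ V]
variable {ι : Type*} [Fintype ι] [DecidableEq ι]

omit [FiniteDimensional ℂ V] in
/-- **An operator with a real matrix commutes with coordinatewise conjugation.** If the matrix of
`T ∈ End V` in the basis `b` has real entries and `κ : V → V` conjugates `b`-coordinates
(`b.repr (κ v) = \overline{b.repr v}`), then `T (κ v) = κ (T v)`: both have `b`-coordinates
`A \overline{x} = \overline{A x}` for `A` the (real) matrix of `T` and `x` the coordinates of `v`.
[folklore] -/
theorem apply_coordConj_of_toMatrix_im_eq_zero (b : Module.Basis ι ℂ V) (T : Module.End ℂ V)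
    (hT : ∀ i j, ((LinearMap.toMatrix b b T) i j).im = 0) (κ : V → V)
    (hκ : ∀ (v : V) (i : ι), b.repr (κ v) i = star (b.repr v i)) (v : V) : T (κ v) = κ (T v) := by
  refine b.ext_elem fun i => ?_
  rw [hκ, ← LinearMap.toMatrix_mulVec_repr b b T v, ← LinearMap.toMatrix_mulVec_repr b b T (κ v)]
  simp only [Matrix.mulVec, dotProduct, star_sum, star_mul', hκ]
  refine Finset.sum_congr rfl fun j _ => ?_
  congr 1
  exact ((Complex.conj_eq_iff_im.mpr (hT i j)).symm : _ = (starRingEnd ℂ) _)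

/-- **A real operator has complex-conjugate determinants on conjugate eigenspaces.** Let `J, M ∈ End V`
have real matrices in the basis `b` (`im = 0` entrywise), let `ν = μ̄`, and let `M` preserve the
eigenspaces `V_μ(J)` and `V_ν(J)`. Then `det (M | V_ν(J)) = conj (det (M | V_μ(J)))`: coordinatewise
conjugation `κ` in `b` is a conjugate-linear involution commuting with `J` and `M`, so it maps `V_μ(J)`
onto `V_{μ̄}(J)` (`J κ v = κ J v = κ (μ v) = μ̄ κ v`) and intertwines the two restrictions of `M`; conclude
by `det_eq_conj_det_of_semilinearEquiv`. Used with `V = H¹(X, ℂ)`, `b` an integral basis, `J = (√-d)^*`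
and `M` a monodromy operator (van Geemen, LNM 1594, 5.8–5.11: level structures give special unitary
monodromy). [folklore] -/
theorem det_restrict_eigenspace_conj (b : Module.Basis ι ℂ V) (J M : Module.End ℂ V)
    (hJ : ∀ i j, ((LinearMap.toMatrix b b J) i j).im = 0)
    (hM : ∀ i j, ((LinearMap.toMatrix b b M) i j).im = 0)
    (μ ν : ℂ) (hν : (starRingEnd ℂ) μ = ν)
    (h₁ : ∀ v ∈ Module.End.eigenspace J μ, M v ∈ Module.End.eigenspace J μ)
    (h₂ : ∀ v ∈ Module.End.eigenspace J ν, M v ∈ Module.End.eigenspace J ν) :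
    LinearMap.det (M.restrict h₂) = (starRingEnd ℂ) (LinearMap.det (M.restrict h₁)) := by
  -- coordinatewise complex conjugation in the basis `b`
  let κ : V ≃ₛₗ[starRingEnd ℂ] V := (b.equivFun.trans (starLinearEquiv ℂ)).trans b.equivFun.symm
  have hκ : ∀ (v : V) (i : ι), b.repr (κ v) i = star (b.repr v i) := fun v i =>
    congrFun (b.equivFun.apply_symm_apply (star (b.equivFun v))) i
  have hκκ : ∀ v, κ (κ v) = v := fun v => b.ext_elem fun i => by rw [hκ, hκ, star_star]
  have hJκ : ∀ v, J (κ v) = κ (J v) := apply_coordConj_of_toMatrix_im_eq_zero b J hJ κ hκ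
  have hMκ : ∀ v, M (κ v) = κ (M v) := apply_coordConj_of_toMatrix_im_eq_zero b M hM κ hκ
  -- `κ` maps `V_α(J)` into `V_ᾱ(J)`
  have hmap : ∀ (α : ℂ) (v : V), v ∈ Module.End.eigenspace J α →
      κ v ∈ Module.End.eigenspace J ((starRingEnd ℂ) α) := fun α v hv => by
    rw [Module.End.mem_eigenspace_iff] at hv ⊢
    rw [hJκ, hv, LinearEquiv.map_smulₛₗ]
  have hE : (Module.End.eigenspace J μ).map (κ : V →ₛₗ[starRingEnd ℂ] V) =
      Module.End.eigenspace J ν := by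
    refine le_antisymm ?_ fun w hw => ?_
    · rintro _ ⟨v, hv, rfl⟩
      rw [← hν]
      exact hmap μ v hv
    · refine ⟨κ w, ?_, hκκ w⟩
      have hw' := hmap ν w hw
      rwa [← hν, starRingEnd_self_apply] at hw'
  exact det_eq_conj_det_of_semilinearEquiv (κ.ofSubmodules _ _ hE) (M.restrict h₁) (M.restrict h₂)
    fun x => Subtype.ext (by
      simp only [LinearMap.restrict_apply, LinearEquiv.ofSubmodules_apply]
      exact hMκ x)

end

end Literature.AlgebraicGeometry.HodgeTheory
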